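import Mathlib.Probability.Distributions.Gaussian.HasGaussianLaw.Basic
import Mathlib.Analysis.SpecialFunctions.Trigonometric.Bounds
import Mathlib.MeasureTheory.Function.L2Space
import HarnessLib

/-!
# Mean-square limits of Gaussian random variables are Gaussian

If real random variables `X n` with Gaussian laws converge in `L²(μ)` to `Y`, then `Y` has a
Gaussian law (with the limiting mean and variance); likewise for `ℝ^ι`-valued random vectors
converging coordinatewise in `L²`.  This is the closure property that makes the closed linear span
of a Gaussian family in `L²` a *Gaussian Hilbert space* (S. Janson, *Gaussian Hilbert Spaces*,
CUP 1997, Ch. 1; standard: characteristic functions `exp(itmₙ - vₙt²/2)`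
converge, and `mₙ → m`, `vₙ → v` by `L²` convergence).

* `hasGaussianLaw_of_tendsto_eLpNorm` — real case;
* `hasGaussianLaw_pi_of_tendsto_eLpNorm` — finite-dimensional (coordinatewise) case.

Mathlib: `HasGaussianLaw`, `charFun`, `Measure.ext_of_charFun`, `charFun_gaussianReal`; the limit
statements were verified absent at the pin (`lean search 'HasGaussianLaw.*tendsto'`).
-/

noncomputable section

open MeasureTheory ProbabilityTheory Filter Complex
open scoped Topology ENNReal InnerProductSpace

namespace Literature.Probability.Distributions

variable {Ω : Type*} {mΩ : MeasurableSpace Ω} {μ : Measure Ω}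

/-! ### Moments along an `L²`-convergent sequence -/

section Moments

variable [IsProbabilityMeasure μ] {X : ℕ → Ω → ℝ} {Y : Ω → ℝ}

/-- `L²` convergence on a probability space implies `L¹` convergence. [folklore] -/
theorem tendsto_eLpNorm_one_of_two (hX : ∀ n, AEStronglyMeasurable (X n) μ)
    (hY : AEStronglyMeasurable Y μ)
    (h : Tendsto (fun n => eLpNorm (X n - Y) 2 μ) atTop (𝓝 0)) :
    Tendsto (fun n => eLpNorm (X n - Y) 1 μ) atTop (𝓝 0) :=
  tendsto_of_tendsto_of_tendsto_of_le_of_le tendsto_const_nhds h (fun _ => zero_le)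
    fun n => eLpNorm_le_eLpNorm_of_exponent_le (by norm_num) ((hX n).sub hY)

/-- Means converge along an `L²`-convergent sequence. [folklore] -/
theorem tendsto_integral_of_tendsto_eLpNorm_two (hX : ∀ n, MemLp (X n) 2 μ) (hY : MemLp Y 2 μ)
    (h : Tendsto (fun n => eLpNorm (X n - Y) 2 μ) atTop (𝓝 0)) :
    Tendsto (fun n => ∫ ω, X n ω ∂μ) atTop (𝓝 (∫ ω, Y ω ∂μ)) :=
  tendsto_integral_of_L1' Y hY.1 (Eventually.of_forall fun n =>
    (hX n).integrable (by norm_num)) (tendsto_eLpNorm_one_of_two (fun n => (hX n).1) hY.1 h)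

omit [IsProbabilityMeasure μ] in
/-- Second moments converge along an `L²`-convergent sequence. [folklore] -/
theorem tendsto_integral_sq_of_tendsto_eLpNorm_two (hX : ∀ n, MemLp (X n) 2 μ) (hY : MemLp Y 2 μ)
    (h : Tendsto (fun n => eLpNorm (X n - Y) 2 μ) atTop (𝓝 0)) :
    Tendsto (fun n => ∫ ω, X n ω ^ 2 ∂μ) atTop (𝓝 (∫ ω, Y ω ^ 2 ∂μ)) := by
  have hL : Tendsto (fun n => (hX n).toLp (X n)) atTop (𝓝 (hY.toLp Y)) :=
    (Lp.tendsto_Lp_iff_tendsto_eLpNorm'' _ hX Y hY).2 h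
  have hsq : ∀ {Z : Ω → ℝ} (hZ : MemLp Z 2 μ), ∫ ω, Z ω ^ 2 ∂μ = ‖hZ.toLp Z‖ ^ 2 := by
    intro Z hZ
    rw [← real_inner_self_eq_norm_sq, MeasureTheory.L2.inner_def]
    refine integral_congr_ae ?_
    filter_upwards [hZ.coeFn_toLp] with ω hω
    rw [hω, RCLike.inner_apply, conj_trivial, pow_two]
  rw [hsq hY]
  simp_rw [hsq (hX _)]
  exact (hL.norm).pow 2

end Moments

/-! ### Characteristic functions of laws of real random variables -/

section CharFun

variable [IsProbabilityMeasure μ]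

/-- `|e^{ia} - e^{ib}| ≤ |a - b|`. [folklore] -/
theorem norm_cexp_mul_I_sub_cexp_mul_I_le (a b : ℝ) :
    ‖cexp (a * I) - cexp (b * I)‖ ≤ |a - b| := by
  have h : cexp (a * I) - cexp (b * I) = cexp (b * I) * (cexp (I * ((a - b : ℝ) : ℂ)) - 1) := by
    rw [mul_sub, mul_one, ← Complex.exp_add]
    congr 2
    push_cast
    ring
  rw [h, norm_mul, Complex.norm_exp_ofReal_mul_I, one_mul]
  exact Real.norm_exp_I_mul_ofReal_sub_one_le.trans (by simp [Real.norm_eq_abs])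

/-- The characteristic functions of the laws of two real random variables differ by at most
`|t| · E|Z - W|`. [folklore] -/
theorem norm_charFun_map_sub_le {Z W : Ω → ℝ} (hZ : AEMeasurable Z μ) (hW : AEMeasurable W μ)
    (hint : Integrable (Z - W) μ) (t : ℝ) :
    ‖charFun (μ.map Z) t - charFun (μ.map W) t‖ ≤ |t| * ∫ ω, |Z ω - W ω| ∂μ := by
  rw [charFun_apply_real, charFun_apply_real, integral_map hZ (by fun_prop),
    integral_map hW (by fun_prop)]
  have hiZ : Integrable (fun ω => cexp (t * Z ω * I)) μ :=
    Integrable.of_bound (by fun_prop) 1 (ae_of_all _ fun ω => by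
      rw [show (t : ℂ) * (Z ω : ℂ) * I = ((t * Z ω : ℝ) : ℂ) * I by push_cast; ring,
        Complex.norm_exp_ofReal_mul_I])
  have hiW : Integrable (fun ω => cexp (t * W ω * I)) μ :=
    Integrable.of_bound (by fun_prop) 1 (ae_of_all _ fun ω => by
      rw [show (t : ℂ) * (W ω : ℂ) * I = ((t * W ω : ℝ) : ℂ) * I by push_cast; ring,
        Complex.norm_exp_ofReal_mul_I])
  rw [← integral_sub hiZ hiW, ← integral_const_mul]
  refine (norm_integral_le_integral_norm _).trans (integral_mono_of_nonneg
    (ae_of_all _ fun ω => norm_nonneg _) (hint.abs.const_mul |t|) (ae_of_all _ fun ω => ?_))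
  have h := norm_cexp_mul_I_sub_cexp_mul_I_le (t * Z ω) (t * W ω)
  simp only [Complex.ofReal_mul] at h
  calc ‖cexp (t * Z ω * I) - cexp (t * W ω * I)‖ ≤ |t * Z ω - t * W ω| := h
    _ = |t| * |Z ω - W ω| := by rw [← mul_sub, abs_mul]
    _ = |t| * |(Z - W) ω| := rfl

end CharFun

/-! ### The limit theorems -/

section Limit

variable [IsProbabilityMeasure μ] {X : ℕ → Ω → ℝ} {Y : Ω → ℝ}

/-- **Mean-square limits of real Gaussian random variables are Gaussian.** If `X n` have Gaussian
laws and `X n → Y` in `L²(μ)`, then `Y` has a Gaussian law (Janson 1997, Ch. 1: Gaussian linear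
spaces are closed under `L²`-limits). Proof: the characteristic functions
`exp (i t mₙ - vₙ t²/2)` converge to that of `Y` (`|e^{itXₙ} - e^{itY}| ≤ |t||Xₙ - Y|`) and to
`exp (i t m - v t²/2)` (`mₙ → m`, `vₙ → v` by `L²` convergence); conclude by
`Measure.ext_of_charFun`. [cite: Janson1997, Ch. 1 (a closed linear span of Gaussian variables in L² is Gaussian)] -/
theorem hasGaussianLaw_of_tendsto_eLpNorm (hX : ∀ n, HasGaussianLaw (X n) μ) (hY : MemLp Y 2 μ)
    (h : Tendsto (fun n => eLpNorm (X n - Y) 2 μ) atTop (𝓝 0)) : HasGaussianLaw Y μ := by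
  have hX2 : ∀ n, MemLp (X n) 2 μ := fun n => (hX n).memLp_two
  have hXa : ∀ n, AEMeasurable (X n) μ := fun n => (hX n).aemeasurable
  have hYa : AEMeasurable Y μ := hY.aestronglyMeasurable.aemeasurable
  -- means and variances converge
  have hm : Tendsto (fun n => μ[X n]) atTop (𝓝 μ[Y]) :=
    tendsto_integral_of_tendsto_eLpNorm_two hX2 hY h
  have hv : Tendsto (fun n => Var[X n; μ]) atTop (𝓝 Var[Y; μ]) := by
    have h2 := tendsto_integral_sq_of_tendsto_eLpNorm_two hX2 hY h
    rw [variance_eq_sub hY]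
    simp_rw [variance_eq_sub (hX2 _)]
    exact (h2.congr fun n => by rfl).sub (hm.pow 2)
  -- characteristic functions converge
  have hL1 : Tendsto (fun n => ∫ ω, |X n ω - Y ω| ∂μ) atTop (𝓝 0) := by
    have h1 := tendsto_eLpNorm_one_of_two (fun n => (hX2 n).1) hY.1 h
    have h1' : Tendsto (fun n => (eLpNorm (X n - Y) 1 μ).toReal) atTop (𝓝 0) := by
      have := (ENNReal.tendsto_toReal ENNReal.zero_ne_top).comp h1
      simpa [Function.comp_def] using this
    refine h1'.congr fun n => ?_
    rw [eLpNorm_one_eq_lintegral_enorm, ← integral_norm_eq_lintegral_enorm ((hX2 n).1.sub hY.1)]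
    rfl
  have hchar : ∀ t : ℝ, charFun (μ.map Y) t =
      cexp (t * (μ[Y] : ℝ) * I - (Var[Y; μ].toNNReal : ℂ) * t ^ 2 / 2) := by
    intro t
    -- limit 1: `charFun (μ.map (X n)) t → charFun (μ.map Y) t`
    have lim1 : Tendsto (fun n => charFun (μ.map (X n)) t) atTop (𝓝 (charFun (μ.map Y) t)) := by
      rw [tendsto_iff_norm_sub_tendsto_zero]
      refine squeeze_zero (fun n => norm_nonneg _)
        (fun n => norm_charFun_map_sub_le (hXa n) hYa
          (((hX2 n).sub hY).integrable (by norm_num)) t) ?_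
      simpa using hL1.const_mul |t|
    -- limit 2: the Gaussian characteristic functions converge to the Gaussian one
    have lim2 : Tendsto (fun n => charFun (μ.map (X n)) t) atTop
        (𝓝 (cexp (t * (μ[Y] : ℝ) * I - (Var[Y; μ].toNNReal : ℂ) * t ^ 2 / 2))) := by
      have hform : ∀ n, charFun (μ.map (X n)) t =
          cexp (t * (μ[X n] : ℝ) * I - (Var[X n; μ].toNNReal : ℂ) * t ^ 2 / 2) := fun n => by
        rw [(hX n).map_eq_gaussianReal, charFun_gaussianReal]
      simp_rw [hform]
      refine (Complex.continuous_exp.tendsto _).comp ?_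
      have hmC : Tendsto (fun n => ((μ[X n] : ℝ) : ℂ)) atTop (𝓝 ((μ[Y] : ℝ) : ℂ)) :=
        (Complex.continuous_ofReal.tendsto _).comp hm
      have hvC : Tendsto (fun n => ((Var[X n; μ].toNNReal : ℝ) : ℂ)) atTop
          (𝓝 ((Var[Y; μ].toNNReal : ℝ) : ℂ)) :=
        (Complex.continuous_ofReal.tendsto _).comp
          ((NNReal.continuous_coe.tendsto _).comp ((continuous_real_toNNReal.tendsto _).comp hv))
      exact ((tendsto_const_nhds.mul hmC).mul tendsto_const_nhds).sub
        ((hvC.mul tendsto_const_nhds).div_const 2)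
    exact tendsto_nhds_unique lim1 lim2
  haveI : IsProbabilityMeasure (μ.map Y) := Measure.isProbabilityMeasure_map hYa
  have hlaw : μ.map Y = gaussianReal μ[Y] Var[Y; μ].toNNReal :=
    Measure.ext_of_charFun (funext fun t => by rw [hchar, charFun_gaussianReal])
  exact ⟨by rw [hlaw]; infer_instance⟩

/-- **Coordinatewise mean-square limits of Gaussian random vectors are Gaussian**: if the
`ℝ^ι`-valued random vectors `X n` (finite `ι`) have Gaussian laws and every coordinate converges
in `L²(μ)` to the corresponding coordinate of `Y`, then `Y` has a Gaussian law. Reduction to the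
real case through the linear forms `L ∘ Y = ∑ᵢ cᵢ Yᵢ` (`isGaussian_of_isGaussian_map`).
[cite: Janson1997, Ch. 1 (a closed linear span of Gaussian variables in L² is Gaussian)] -/
theorem hasGaussianLaw_pi_of_tendsto_eLpNorm {ι : Type*} [Fintype ι] {X : ℕ → Ω → ι → ℝ}
    {Y : Ω → ι → ℝ} (hX : ∀ n, HasGaussianLaw (X n) μ) (hY : ∀ i, MemLp (fun ω => Y ω i) 2 μ)
    (h : ∀ i, Tendsto (fun n => eLpNorm (fun ω => X n ω i - Y ω i) 2 μ) atTop (𝓝 0)) :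
    HasGaussianLaw Y μ := by
  have hYa : AEMeasurable Y μ :=
    aemeasurable_pi_lambda _ fun i => (hY i).aestronglyMeasurable.aemeasurable
  have hXi : ∀ n i, MemLp (fun ω => X n ω i) 2 μ := fun n i =>
    (HasGaussianLaw.eval (X := fun i ω => X n ω i) (hX n) i).memLp_two
  classical
  refine ⟨isGaussian_of_isGaussian_map fun L => ?_⟩
  rw [AEMeasurable.map_map_of_aemeasurable (by fun_prop) hYa]
  set c : ι → ℝ := fun i => L fun j => if i = j then 1 else 0 with hc
  have hdecomp : ∀ x : ι → ℝ, L x = ∑ i, c i * x i := fun x => by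
    rw [show L x = L.toLinearMap x from rfl, LinearMap.pi_apply_eq_sum_univ]
    refine Finset.sum_congr rfl fun i _ => ?_
    rw [smul_eq_mul, mul_comm, hc]
    rfl
  have hXL : ∀ n, HasGaussianLaw (L ∘ X n) μ := fun n => (hX n).map L
  have hYL : MemLp (L ∘ Y) 2 μ := by
    have heq : (L ∘ Y) = fun ω => ∑ i, c i * Y ω i := funext fun ω => hdecomp (Y ω)
    rw [heq]
    exact memLp_finsetSum _ fun i _ => (hY i).const_mul (c i)
  have hlim : Tendsto (fun n => eLpNorm (L ∘ X n - L ∘ Y) 2 μ) atTop (𝓝 0) := by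
    have heq : ∀ n, (L ∘ X n - L ∘ Y) = ∑ i, fun ω => c i * (X n ω i - Y ω i) := by
      intro n
      funext ω
      simp only [Pi.sub_apply, Function.comp_apply, Finset.sum_apply, hdecomp, mul_sub]
      rw [Finset.sum_sub_distrib]
    have hbound : ∀ n, eLpNorm (L ∘ X n - L ∘ Y) 2 μ ≤
        ∑ i, ‖c i‖ₑ * eLpNorm (fun ω => X n ω i - Y ω i) 2 μ := fun n => by
      rw [heq n]
      refine (eLpNorm_sum_le (fun i _ => ?_) (by norm_num)).trans (Finset.sum_le_sum fun i _ => ?_)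
      · exact (((hXi n i).sub (hY i)).const_mul (c i)).1
      · have : (fun ω => c i * (X n ω i - Y ω i)) = c i • fun ω => X n ω i - Y ω i := rfl
        rw [this]
        exact eLpNorm_const_smul_le
    have hsum : Tendsto (fun n => ∑ i, ‖c i‖ₑ * eLpNorm (fun ω => X n ω i - Y ω i) 2 μ) atTop
        (𝓝 0) := by
      rw [show (0 : ℝ≥0∞) = ∑ i : ι, ‖c i‖ₑ * 0 by simp]
      exact tendsto_finsetSum _ fun i _ => ENNReal.Tendsto.const_mul (h i) (Or.inr enorm_ne_top)
    exact tendsto_of_tendsto_of_tendsto_of_le_of_le tendsto_const_nhds hsum (fun _ => zero_le) hbound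
  exact (hasGaussianLaw_of_tendsto_eLpNorm hXL hYL hlim).isGaussian_map

end Limit

end Literature.Probability.Distributions
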